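import Summits.FinalStateConjecture.FinalStateConjecture.Theorems.SwallowTheDatumParametricKerrBurialCollarDilation
import Summits.FinalStateConjecture.FinalStateConjecture.Theorems.SwallowTheDatumParametricKerrBurialStubTransportPatch
import Summits.FinalStateConjecture.FinalStateConjecture.Theorems.SwallowTheDatumParametricKerrBurialStubBreathing

/-!
# `ParametricKerrBurial` reduced to far gluing + one universal collar datum (line `receding-annulus-universal-collar`,
# crux stmt-FinalStateConjecture-10052) — the line's state after cycle 1 of the lead

With the dilation covariance of the collar (`CollarDilation.stub_collarDilation`, p84287), the transport-and-patch engine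
(`stub_transportPatch`, p91483), the breathing engine (`stub_breathing`, p86339), the junction lemma and the composition
(`ParametricKerrBurial_of`, p74984) all in the tree, the crux follows from exactly TWO statements, both the size of published
theorems and neither provable inside the tree today:

* (A) `stub_farGluing` — receding obstruction-free annular gluing of the admissible datum onto a growing exact isotropic
  Schwarzschild seed, smooth in the gluing radius (Mao–Oh–Tao arXiv:2308.13031 Thm 1.7/1.10, Rem 1.9; the C^∞ dependence
  on the radius is unprinted);
* (B) `stub_collarDatum` — ONE admissible vacuum datum on `ℝ³`, exactly isotropic Schwarzschild(`μ`), `k = 0`, on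
  `{1 < ‖y‖ < 2}`, Kerr-shielded beyond radius `2` (it contains the sibling crux `KerrShieldedDataExist`, item 10055, and in
  addition a vacuum mass jump `μ → M` below the shield, i.e. a non-spherical collapsed pulse: Li–Mei arXiv:2005.01249 Thm 2.2
  plus one gluing engine).

`ParametricKerrBurial_of_farGluing_of_collarDatum : (A) → (B) → ParametricKerrBurial` records this; it is explicitly
CONDITIONAL (registered sub-goal of the crux item), not a proof of the item.
-/

set_option linter.dupNamespace false

noncomputable section

namespace Summit.FinalStateConjecture.FinalStateConjecture.Theorems.SwallowTheDatum.ParametricKerrBurial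

open scoped Manifold ContDiff Topology
open Bundle Set Filter Function Literature.Geometry.Lorentzian

/-- **The crux from far gluing (A) and the universal collar (B) alone**: the three engine stubs of the line are tree
theorems, so `ParametricKerrBurial_of` specialises to a two-hypothesis reduction.  Hypotheses = the registered signatures
of `stub_farGluing` and `stub_collarDatum` verbatim. [folklore] -/
theorem ParametricKerrBurial_of_farGluing_of_collarDatum :
    (∀ (X : Type) [TopologicalSpace X] [ChartedSpace E3 X] [IsManifold (𝓡 3) ∞ X] [T2Space X]
      [SecondCountableTopology X] [ConnectedSpace X], ∀ d ∈ admissibleVacuumData X,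
      ∃ (η : ℝ) (e : AFEnd X) (Rstar : ℝ) (m : ℝ → ℝ) (G : ℝ → InitialDataSet (𝓡 3) X),
        0 < η ∧ e.IsSoleEnd ∧ e.R < Rstar ∧ ContDiff ℝ ∞ m ∧ SmoothSectionsOn 𝓘(ℝ, ℝ) G {p : ℝ × X | Rstar < p.1} ∧
        ∀ R : ℝ, Rstar < R → G R ∈ admissibleVacuumData X ∧ (∀ x ∉ e.far R, AgreeAt (G R) d x) ∧
          η * R ≤ m R ∧ IsExactSchwarzschildBeyond e (G R) (m R) (32 * R)) →
    (∀ [Kerr.Facts], ∀ μ₀ : ℝ, 0 < μ₀ → ∃ μ : ℝ, 0 < μ ∧ μ ≤ μ₀ ∧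
      ∃ C ∈ admissibleVacuumData E3, IsSchwarzschildAnnulus C μ ∧ IsKerrShieldedAway 2 C) →
    Summit.FinalStateConjecture.FinalStateConjecture.Theses.SwallowTheDatum.ParametricKerrBurial :=
  fun hA hB ↦ ParametricKerrBurial_of hA hB CollarDilation.stub_collarDilation stub_transportPatch stub_breathing

end Summit.FinalStateConjecture.FinalStateConjecture.Theorems.SwallowTheDatum.ParametricKerrBurial

end
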